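/-
Copyright (c) 2026 the pub-hodgecm-mathlib formalisation cell (harness21).  Prover seat hodgecm-mathlib-K2E5-p16 (g8): Track B «K2-LIT»,
hLiu418 = stmt-HodgeConjecture-24832; LEAD F0P6-plan (g14) BATCH #85 (1) «K1-a♮» (line lead K2E5-p16 (g8)), file (K1a-2d), ED. 1 (hypothesis-first);
ED. 2: §4 the PER-PLACE DISCHARGE of the twisted D10 value at a good place (non-split ★ p862724 ∕ split ★ p862837 + ★ p862774 + 📤 p862906).
-/
import Summits.HodgeConjecture.HodgeConjecture.Theorems.K2LiuSphericalSectionLambdaLoc     -- ★ (4c) `isSphericalSection_lambdaLoc` (+ ★ D10, ★ D7c `LambdaLoc`)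
import Summits.HodgeConjecture.HodgeConjecture.Theorems.K2LiuUnipDeltaLocBridge           -- ★ B1 `unipDeltaLoc_eq_unipDeltaLocal`
import Summits.HodgeConjecture.HodgeConjecture.Theorems.K2LiuLocalWhittakerFactorSkew     -- ★ `evalPlace_finPart_weylDelta`
import Summits.HodgeConjecture.HodgeConjecture.Theorems.K2LiuSiegelUnipotentCharacterFactorisation  -- ★ (d1) `unipDeltaChar`, `locToAdelic` letters
import Summits.HodgeConjecture.HodgeConjecture.Theorems.K2LiuSphericalSiegelValueCM            -- ★ (F-GK-4) `measureReal_localInt_eq_one`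
import Summits.HodgeConjecture.HodgeConjecture.Theorems.K2LiuRankOneSingularLocalValue          -- ★ (K1a-2b) p862724 (non-split twisted cocycle value)
import Summits.HodgeConjecture.HodgeConjecture.Theorems.K2LiuRankOneSingularLocalValueSplit     -- ★ (K1a-2c) p862837 (split twin, F0P2-p09)
import Summits.HodgeConjecture.HodgeConjecture.Theorems.K2LiuRankOneWhittakerPolynomialSigned   -- ★ p862774 (LH7-p06): the twisted rank-one stage
import Summits.HodgeConjecture.HodgeConjecture.Theorems.K2LiuRankOneCornerCharacterReading      -- 📤 p862906: the corner character in the frame (σ)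
import Summits.HodgeConjecture.HodgeConjecture.Theorems.K2LiuSiegelCocycleSphericalLocalInt     -- ★ p862425 FILE B part 2 (brings part 1 letters-in-K, FILE A unit scalars)
import Summits.HodgeConjecture.HodgeConjecture.Theorems.K2LiuGKRankOneIdentityLFactor           -- ★ `isUnramifiedChar_chiF`
import HarnessLib

/-!
# Crux `HLiu418`, road `K2_Liu`, socket #41 KIND 1 a♮, organ (K1a-GK), file (K1a-2d), ED. 1:
# THE TWISTED LOCAL FACTOR `∫_{N_Δ(L⁺_v)} conj ψ_S(ι_v y) · Λ_{s,v}((w_Δ)_v y) dν_v(y)` OF ★ G1 AT THE CM DATUM, FROM THE D10-CURRENCY TWISTED VALUE (hypothesis-first)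

Cell `hodgecm-mathlib`, crux item hLiu418 = `stmt-HodgeConjecture-24832`; squad K2 ∕ K2Liu; prover K2E5-p16 (g8) = line lead of K1-a♮; consumers (K1a-4) R90-C14-p02 (g0)
`K2LiuRankOneSingularEulerContinued` (tail letter `hK1a2`) and row (5) LH4-p11 (g10) `K2LiuRankOneSingularValuePresentation`.  THEOREMS ONLY (no `def`, no instance,
no notation, no named-fact hypothesis, no `sorry`); lane `--supports stmt-HodgeConjecture-24832 --as helper` (count-neutral helper).

THE SEAM (the twisted twin of ★ (F-GK-4) `K2LiuSphericalSiegelValueCM`).  ★ G1 `K2LiuWhittakerDeltaEulerProduct.whittakerDelta_eq_mul_tprod_euler` carries, off `T`, the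
local factor `∫ y, conj ψ_S(ι_v y) · Λ_{s,v}((w_Δ)_v · y) dν_v(y)` over the GLOBAL-COMAP subgroup `unipDeltaLoc v` (★ Φ3b) with ★ (E3)'s normalisation
`ν_v(K_{H,v} ∩ N_Δ) = 1`.  The producer (K1a-2b) 📤 p862724 `K2LiuRankOneSingularLocalValue` (and its split twin (K1a-2c)) speaks ★ D10: an integral over
`LocalSiegelDoubled.unipDeltaLocal` of `ψ_v(b₁(u)·τ) · f(w_Δ u)` for a spherical `f` at the generic doubled datum.  This file is the currency transport at the CM datum,
HYPOTHESIS-FIRST on the D10-side twisted value (ED. 1); ED. 2 plugs (2b)∕(2c) with the character reading `conj ψ_{S♭}(ι_v u) = ψ_v(b₁(u)·τ)`, `τ = 2·t₁·σ♭·δ`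
(★ (d1) `unipDeltaChar_locToAdelic_eq_prod`, ★ B1 §3 `trace_mul_toBlocks₁₂_component_nElem`, ★ `adapt_matA_frameConj_nSiegel`, ★ `prod_adicComponent_adeleAddChar_eq`)
and the cofinite good-place letters (★ `exists_finset_forall_placeLetters_cm` of ★ F-GK-4 ED. 3, frame antidiagonality).
* §1 `integral_mul_weylDelta_eq_of_forall` (generic doubled datum, any rank `n`) — a D10 identity `∫ Ψ(u) f(w_Δ u) dνN = R(νN(N_Δ ∩ K_v))` for all Haar `νN` on
  `unipDeltaLocal` and all spherical `f` transports to ANY subgroup `N′ = unipDeltaLocal` and Haar measure `ν` on `N′` (`subst`; the twist `Ψ : H_v → ℂ` rides along).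
* §2 **`integral_conjChar_lambdaLoc_weylDelta_eq_of_forall`** (CM datum, `n = 2`): if at `v` the twisted D10 value is `R(vol)` for `χ_v := (χ.localComponent ·)` and the twist
  `Ψ := conj ψ_S(ι_v ·)` (binder `hGK` — the head of (K1a-2b)∕(2c) at a good place), then for every Haar `ν` on `unipDeltaLoc v`:
  **`∫ y, conj ψ_S(ι_v y) · Λ_{s,v}((w_Δ)_v · y) dν(y) = R(ν{u | ↑u ∈ K_{H,v}})`** (★ B1, ★ `evalPlace_finPart_weylDelta`, ★ `isSphericalSection_lambdaLoc`) — with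
  `…_eq_one_…` the normalised form under `ν(K_{H,v} ∩ N_Δ) = 1`.
* §3 **`exists_finset_forall_integral_conjChar_lambdaLoc_weylDelta_eq`** — the COFINITE letter `hK1a2` of (K1a-4): hypothesis-first on a cofinite family of twisted D10 values
  `hGK : ∀ v ∉ T₁, ∀ s, 1 < re s → (… = Val v s (vol))`, conclusion `∃ T₀, ∀ v ∉ T₀, ∀ ν, ν(K ∩ N) = 1 → ∀ s, 1 < re s → ∫ … = Val v s 1` (`Val` BY VALUE: ED. 2 instantiates it
  with the record's `(1 − q_v^{−(2s+1)})(1 − ε_v q_v^{−(2s+2)})∕(1 − q_v^{−2s}) · Σ_{k ≤ m_v} (ε_v q_v^{1−2s})^k`).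
* §4 (ED. 2) **`twistedValue_of_isSphericalSection_of_forall_eq`** (non-split good place) ∕ **`…_of_pair`** (split) — THE DISCHARGE of §2's binder `hGK` at ONE place:
  for every Haar `νN` on `N_Δ(L⁺_v)` and every spherical section `f` of `I_v(s, (χ_w)_{w∣v})` (`1 < re s`), in the ★ B8-CM frame with its blocks exposed
  (📤 p862906 `exists_adaptedFrame_eq`: `D⁻¹ = 2·W·gramR`), at a good place (`IsGoodPlace`, frame integral, `χ_w` unitary) and with `τ_v := ι_v(t₁·Tr(σδ)) ∈ 𝔭^M ∖ 𝔭^{M+1}`: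
  **`∫ conj ψ_{single 1 1 σ}(ι_v y) · f(w_Δ y) dνN(y) = νN{u | ↑u ∈ K_v} · [L_F(2s+1,χ_F)∕L_F(2s+2,χ_F)] · [∏ L_{E_w}(2s,χ∘N)∕L_{E_w}(2s+1,χ∘N)] · L_F(2s,χ_F)⁻¹ · Σ_{k≤M} (χ_F(ϖ)q^{1−2s})^k`**
  — ★ (K1a-2b)∕(2c) at `K₀ := K_v`, `h := 1` (letters in `K_v` by ★ p862397 §2, box by §3), the character by 📤 p862906 §3, the twisted stage `htw` by ★ p862774
  `integrable_and_integral_addChar_mul_apply_eq` ∕ `…_eq_lFactor_inv_mul_sum` (`C₃ = 1`, ★ FILE A §2), the unit scalars `χ_s(m₀) = C₁ = χ_w(−1) = 1` by ★ FILE A §2,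
  `G = L(e−1)∕L(e)` by ★ F-GK-1 `one_add_eq_lFactor_div_lFactor`.
HONEST LABEL.  `HC_CM` is proved only modulo the 7 printed citations (2 remaining named inputs: hLiu418 = `stmt-HodgeConjecture-24832`,
h413 = `stmt-HodgeConjecture-24833`) until rung 0 closes.

## References
* [KudlaRallis1994] S. Kudla, S. Rallis, Ann. of Math. 140 (1994), §2.   * [Shimura1997] G. Shimura, CBMS 93 (1997), §18.3–18.4.
* [Liu2011] Y. Liu, Algebra Number Theory 5 (2011), §2B p. 862, §2C (2-4) p. 863.   * [Casselman1980] W. Casselman, Compositio Math. 40 (1980), §3 Thm. 3.1.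
* [Tan1999] V. Tan, Canad. J. Math. 51 (1999), §2–§3 (`W_β = ⊗_v W_{β,v}`).   * [Kudla1994] S. Kudla, Israel J. Math. 87 (1994), §3.
-/

set_option autoImplicit false
set_option linter.dupNamespace false -- the mandated namespace repeats `HodgeConjecture.HodgeConjecture`

noncomputable section

open scoped NNReal ENNReal ComplexConjugate
open NumberField IsDedekindDomain Matrix MeasureTheory
open Literature.NumberTheory.Automorphic Literature.NumberTheory.Automorphic.UnitaryGroup Literature.NumberTheory.GaloisRepresentations
open Literature.NumberTheory.GelbartRogawski1991 Literature.NumberTheory.GelbartRogawski1991.GRConstruction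
open Literature.NumberTheory.GelbartRogawski1991.AdaptedBlocks
open Literature.NumberTheory.GelbartRogawski1991.UnitaryDualPair Literature.NumberTheory.GelbartRogawski1991.UnitaryDualPair.LocalSplitting
open Literature.NumberTheory.K2Lit Literature.NumberTheory.K2Lit.SiegelDoubled Literature.NumberTheory.K2Lit.LocalSiegelDoubled
open Literature.Topology.Algebra.RestrictedProduct (inH)
open Summit.HodgeConjecture.HodgeConjecture.Cruxes.HLiu418.K2LiuSiegelUnipotentLocalDefs
open Summit.HodgeConjecture.HodgeConjecture.Cruxes.HLiu418.K2LiuSiegelUnipotentFourierDefs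
open Summit.HodgeConjecture.HodgeConjecture.Cruxes.HLiu418.K2LiuSiegelUnipotentCharacters
open Summit.HodgeConjecture.HodgeConjecture.Cruxes.HLiu418.K2LiuUnipDeltaLocBridge
open Summit.HodgeConjecture.HodgeConjecture.Cruxes.HLiu418.K2LiuLocalWhittakerFactorSkew (evalPlace_finPart_weylDelta)
open Summit.HodgeConjecture.HodgeConjecture.Cruxes.HLiu418.K2LiuSphericalSectionLambdaLoc (isSphericalSection_lambdaLoc)

namespace Summit.HodgeConjecture.HodgeConjecture.Cruxes.HLiu418.K2LiuRankOneSingularLocalValueCM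

/-! ## §1 Generic doubled datum: transport of a twisted D10 identity to any subgroup equal to `unipDeltaLocal` -/

section Transport

variable (F : Type) [Field F] [NumberField F] (E : Type) [Field E] [NumberField E] [Algebra F E]
  [Algebra.IsQuadraticExtension F E] (c : E ≃ₐ[F] E)
  {δ : E} (hcδ : c δ = -δ) (hδ : δ ≠ 0) {d : F} (hd : δ * δ = algebraMap F E d) (v : HeightOneSpectrum (𝓞 F)) (n : ℕ)
  {T₀ : Matrix (Fin n) (Fin n) F} (hT₀ : T₀.IsSymm) {JD : Matrix (Fin (n + n)) (Fin (n + n)) E} (hJD : JD = (gramD F n T₀).map (algebraMap F E))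

/-- **TRANSPORT OF A TWISTED D10 VALUE TO ANY SUBGROUP `N′ = unipDeltaLocal`** (`subst`): if `∫ Ψ(u)·f(w_Δ u) dνN = R(νN{u | ↑u ∈ K_v})` for every Haar measure `νN` on
★ D10's `unipDeltaLocal` and every spherical section `f` of `I_v(s, χ_v)`, then the same holds for every Haar measure `ν` on `N′` (the twist `Ψ : H_v → ℂ` rides along).
[cite: Casselman1980, §3] [cite: KudlaRallis1994, §2] -/
theorem integral_mul_weylDelta_eq_of_forall
    {N' : Subgroup (UnitaryGroup.localPi E c (n + n) JD v)} (hN' : N' = unipDeltaLocal F E c v n (JD := JD))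
    [MeasurableSpace N'] [BorelSpace N'] (ν : Measure N') [ν.IsHaarMeasure]
    (χv : ∀ w : PlacesOver E v, (w.1.adicCompletion E)ˣ →* ℂˣ) (s : ℂ) (Ψ : UnitaryGroup.localPi E c (n + n) JD v → ℂ) (R : ℝ → ℂ)
    (hGK : ∀ {_ : MeasurableSpace (unipDeltaLocal F E c v n (JD := JD))} [BorelSpace (unipDeltaLocal F E c v n (JD := JD))]
      (νN : Measure (unipDeltaLocal F E c v n (JD := JD))) [νN.IsHaarMeasure] (f : UnitaryGroup.localPi E c (n + n) JD v → ℂ),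
      IsSphericalSection F E c hcδ hδ hd v n hT₀ hJD χv s f →
        ∫ u, Ψ (u : UnitaryGroup.localPi E c (n + n) JD v) * f (weylDelta F E c v n hJD * (u : UnitaryGroup.localPi E c (n + n) JD v)) ∂νN =
          R (νN.real {u | (u : UnitaryGroup.localPi E c (n + n) JD v) ∈ UnitaryGroup.localInt E c (n + n) JD v}))
    {f : UnitaryGroup.localPi E c (n + n) JD v → ℂ} (hf : IsSphericalSection F E c hcδ hδ hd v n hT₀ hJD χv s f) :
    ∫ u : N', Ψ (u : UnitaryGroup.localPi E c (n + n) JD v) * f (weylDelta F E c v n hJD * (u : UnitaryGroup.localPi E c (n + n) JD v)) ∂ν =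
      R (ν.real {u : N' | (u : UnitaryGroup.localPi E c (n + n) JD v) ∈ UnitaryGroup.localInt E c (n + n) JD v}) := by
  subst hN'
  exact hGK ν f hf

end Transport

/-! ## §2 The CM datum: the twisted (K1-a) face from the twisted D10 value -/

section CM

variable (L : Type) [Field L] [NumberField L] [IsCMField L] {N M : ℕ} (e : Fin N × Fin M ≃ Fin 2)
  (dV : Fin N → L) (hdV : ∀ i, IsCMField.complexConj L (dV i) = dV i)
  (dW : Fin M → L) (hdW : ∀ i, IsCMField.complexConj L (dW i) = dW i)
  (v : HeightOneSpectrum (𝓞 (Fp L)))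
  [MeasurableSpace ↥(unipDeltaLoc L e dV hdV dW hdW v)] [BorelSpace ↥(unipDeltaLoc L e dV hdV dW hdW v)] (ν : Measure ↥(unipDeltaLoc L e dV hdV dW hdW v)) [ν.IsHaarMeasure]
  (S : Matrix (Fin 2) (Fin 2) L) (χ : HeckeCharacter L) (hχ : ∀ w : UnitaryGroup.PlacesOver L v, χ.IsUnramifiedAt w.1) (s : ℂ)

include hχ in
set_option maxHeartbeats 800000 in -- as ★ (F-GK-4) §2 (the K2Lit CM datum's binder telescope: 200 000 ✗ `whnf` ∕ 400 000 ✗ ∕ 800 000 ✓ there); plain `rw`∕`exact`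
/-- **THE TWISTED (K1-a) FACE FROM THE TWISTED D10 VALUE, CM DATUM** (hypothesis-first): if at `v`, for the twist `Ψ = conj ψ_S(ι_v ·)` and every Haar `νN`, every spherical
section `f` of `I_v(s, (χ.localComponent ·))` has `∫ Ψ(u) f(w_Δ u) dνN = R(νN{u | ↑u ∈ K_{H,v}})` (binder `hGK` — the head of (K1a-2b)∕(2c) at a good place), then for every
Haar measure `ν` on the global-comap `N_Δ(L⁺_v) = unipDeltaLoc v`:
**`∫ y, conj ψ_S(ι_v y) · Λ_{s,v}((w_Δ)_v · y) dν(y) = R(ν{u | ↑u ∈ K_{H,v}})`** — the local factor of ★ G1 at the index `S` (★ B1, ★ `evalPlace_finPart_weylDelta`, ★ `isSphericalSection_lambdaLoc`).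
[cite: Tan1999, §3] [cite: KudlaRallis1994, §2] [cite: Liu2011, §2B p. 862] -/
theorem integral_conjChar_lambdaLoc_weylDelta_eq_of_forall (R : ℝ → ℂ)
    (hGK : haveI : Algebra.IsQuadraticExtension (Fp L) L := IsCMField.isQuadraticExtension L
      ∀ {_ : MeasurableSpace ↥(unipDeltaLocal (Fp L) L (IsCMField.complexConj L) v 2 (JD := hermD L e dV hdV dW hdW))} [BorelSpace ↥(unipDeltaLocal (Fp L) L (IsCMField.complexConj L) v 2 (JD := hermD L e dV hdV dW hdW))] (νN : Measure ↥(unipDeltaLocal (Fp L) L (IsCMField.complexConj L) v 2 (JD := hermD L e dV hdV dW hdW))) [νN.IsHaarMeasure] (f : UnitaryGroup.localPi L (IsCMField.complexConj L) (2 + 2) (hermD L e dV hdV dW hdW) v → ℂ),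
        IsSphericalSection (Fp L) L (IsCMField.complexConj L) (complexConj_imagUnit L) (imagUnit_ne_zero L) (imagUnit_mul_self L) v 2 (gramR_isSymm L e dV hdV dW hdW) (hermD_eq_map_gramD L e dV hdV dW hdW) (fun w : UnitaryGroup.PlacesOver L v => χ.localComponent w.1) s f →
          ∫ y, conj ((unipDeltaChar L e dV hdV dW hdW S (locToAdelic L e dV hdV dW hdW v (y : UnitaryGroup.localPi L (IsCMField.complexConj L) (2 + 2) (hermD L e dV hdV dW hdW) v)) : Circle) : ℂ) * f (weylDelta (Fp L) L (IsCMField.complexConj L) v 2 (hermD_eq_map_gramD L e dV hdV dW hdW) * (y : UnitaryGroup.localPi L (IsCMField.complexConj L) (2 + 2) (hermD L e dV hdV dW hdW) v)) ∂νN = R (νN.real {u | (u : UnitaryGroup.localPi L (IsCMField.complexConj L) (2 + 2) (hermD L e dV hdV dW hdW) v) ∈ UnitaryGroup.localInt L (IsCMField.complexConj L) (2 + 2) (hermD L e dV hdV dW hdW) v})) :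
    ∫ y, conj ((unipDeltaChar L e dV hdV dW hdW S (locToAdelic L e dV hdV dW hdW v (y : UnitaryGroup.localPi L (IsCMField.complexConj L) (2 + 2) (hermD L e dV hdV dW hdW) v)) : Circle) : ℂ) * LambdaLoc L e dV hdV dW hdW v χ s (UnitaryGroup.evalPlace (Fp L) L (IsCMField.complexConj L) (2 + 2) (hermD L e dV hdV dW hdW) v (UnitaryGroup.finPart (Fp L) L (IsCMField.complexConj L) (2 + 2) (hermD L e dV hdV dW hdW) (SiegelDoubled.weylDelta L e dV hdV dW hdW)) * (y : UnitaryGroup.localPi L (IsCMField.complexConj L) (2 + 2) (hermD L e dV hdV dW hdW) v)) ∂ν =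
      R (ν.real {u | (u : UnitaryGroup.localPi L (IsCMField.complexConj L) (2 + 2) (hermD L e dV hdV dW hdW) v) ∈ UnitaryGroup.localInt L (IsCMField.complexConj L) (2 + 2) (hermD L e dV hdV dW hdW) v}) := by
  haveI : Algebra.IsQuadraticExtension (Fp L) L := IsCMField.isQuadraticExtension L
  rw [evalPlace_finPart_weylDelta]
  exact integral_mul_weylDelta_eq_of_forall (Fp L) L (IsCMField.complexConj L) (complexConj_imagUnit L) (imagUnit_ne_zero L) (imagUnit_mul_self L) v 2
    (gramR_isSymm L e dV hdV dW hdW) (hermD_eq_map_gramD L e dV hdV dW hdW) (unipDeltaLoc_eq_unipDeltaLocal L e dV hdV dW hdW v) ν _ s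
    (fun g : UnitaryGroup.localPi L (IsCMField.complexConj L) (2 + 2) (hermD L e dV hdV dW hdW) v => conj ((unipDeltaChar L e dV hdV dW hdW S (locToAdelic L e dV hdV dW hdW v g) : Circle) : ℂ)) R hGK
    (isSphericalSection_lambdaLoc L e dV hdV dW hdW v χ s hχ)

include hχ in
set_option maxHeartbeats 800000 in -- as the previous theorem (same telescope)
/-- **THE SAME UNDER ★ (E3)'s NORMALISATION** `ν(K_{H,v} ∩ N_Δ(L⁺_v)) = 1`: `∫ y, conj ψ_S(ι_v y) · Λ_{s,v}((w_Δ)_v · y) dν(y) = R 1`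
(★ F-GK-4 `measureReal_localInt_eq_one`). [cite: Liu2011, §2B p. 862] [cite: Tan1999, §3] -/
theorem integral_conjChar_lambdaLoc_weylDelta_eq_one_of_forall (R : ℝ → ℂ)
    (hνK : ν (((inH (fun v => UnitaryGroup.localInt L (IsCMField.complexConj L) (2 + 2) (hermD L e dV hdV dW hdW) v) (fun v => unipDeltaLoc L e dV hdV dW hdW v) v) :
      Subgroup ↥(unipDeltaLoc L e dV hdV dW hdW v)) : Set ↥(unipDeltaLoc L e dV hdV dW hdW v)) = 1)
    (hGK : haveI : Algebra.IsQuadraticExtension (Fp L) L := IsCMField.isQuadraticExtension L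
      ∀ {_ : MeasurableSpace ↥(unipDeltaLocal (Fp L) L (IsCMField.complexConj L) v 2 (JD := hermD L e dV hdV dW hdW))} [BorelSpace ↥(unipDeltaLocal (Fp L) L (IsCMField.complexConj L) v 2 (JD := hermD L e dV hdV dW hdW))] (νN : Measure ↥(unipDeltaLocal (Fp L) L (IsCMField.complexConj L) v 2 (JD := hermD L e dV hdV dW hdW))) [νN.IsHaarMeasure] (f : UnitaryGroup.localPi L (IsCMField.complexConj L) (2 + 2) (hermD L e dV hdV dW hdW) v → ℂ),
        IsSphericalSection (Fp L) L (IsCMField.complexConj L) (complexConj_imagUnit L) (imagUnit_ne_zero L) (imagUnit_mul_self L) v 2 (gramR_isSymm L e dV hdV dW hdW) (hermD_eq_map_gramD L e dV hdV dW hdW) (fun w : UnitaryGroup.PlacesOver L v => χ.localComponent w.1) s f →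
          ∫ y, conj ((unipDeltaChar L e dV hdV dW hdW S (locToAdelic L e dV hdV dW hdW v (y : UnitaryGroup.localPi L (IsCMField.complexConj L) (2 + 2) (hermD L e dV hdV dW hdW) v)) : Circle) : ℂ) * f (weylDelta (Fp L) L (IsCMField.complexConj L) v 2 (hermD_eq_map_gramD L e dV hdV dW hdW) * (y : UnitaryGroup.localPi L (IsCMField.complexConj L) (2 + 2) (hermD L e dV hdV dW hdW) v)) ∂νN = R (νN.real {u | (u : UnitaryGroup.localPi L (IsCMField.complexConj L) (2 + 2) (hermD L e dV hdV dW hdW) v) ∈ UnitaryGroup.localInt L (IsCMField.complexConj L) (2 + 2) (hermD L e dV hdV dW hdW) v})) :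
    ∫ y, conj ((unipDeltaChar L e dV hdV dW hdW S (locToAdelic L e dV hdV dW hdW v (y : UnitaryGroup.localPi L (IsCMField.complexConj L) (2 + 2) (hermD L e dV hdV dW hdW) v)) : Circle) : ℂ) * LambdaLoc L e dV hdV dW hdW v χ s (UnitaryGroup.evalPlace (Fp L) L (IsCMField.complexConj L) (2 + 2) (hermD L e dV hdV dW hdW) v (UnitaryGroup.finPart (Fp L) L (IsCMField.complexConj L) (2 + 2) (hermD L e dV hdV dW hdW) (SiegelDoubled.weylDelta L e dV hdV dW hdW)) * (y : UnitaryGroup.localPi L (IsCMField.complexConj L) (2 + 2) (hermD L e dV hdV dW hdW) v)) ∂ν = R 1 := by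
  rw [integral_conjChar_lambdaLoc_weylDelta_eq_of_forall L e dV hdV dW hdW v ν S χ hχ s R hGK,
    Summit.HodgeConjecture.HodgeConjecture.Cruxes.HLiu418.K2LiuSphericalSiegelValueCM.measureReal_localInt_eq_one L e dV hdV dW hdW v ν hνK]

end CM

/-! ## §3 The cofinite letter `hK1a2` of (K1a-4), hypothesis-first on the cofinite family of twisted D10 values -/

section Cofinite

variable (L : Type) [Field L] [NumberField L] [IsCMField L] {N M : ℕ} (e : Fin N × Fin M ≃ Fin 2)
  (dV : Fin N → L) (hdV : ∀ i, IsCMField.complexConj L (dV i) = dV i)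
  (dW : Fin M → L) (hdW : ∀ i, IsCMField.complexConj L (dW i) = dW i)
  [∀ v : HeightOneSpectrum (𝓞 (Fp L)), MeasurableSpace ↥(unipDeltaLoc L e dV hdV dW hdW v)]
  [∀ v : HeightOneSpectrum (𝓞 (Fp L)), BorelSpace ↥(unipDeltaLoc L e dV hdV dW hdW v)]
  (S : Matrix (Fin 2) (Fin 2) L) (χ : HeckeCharacter L)

set_option maxHeartbeats 800000 in -- as §2 (the statement repeats the `hGK` telescope under two more binders)
/-- **THE COFINITE TWISTED LOCAL FACTOR (hypothesis-first) — the tail letter `hK1a2` of (K1a-4) `K2LiuRankOneSingularEulerContinued`.**  Let `Val : place → ℂ → ℝ → ℂ` be BY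
VALUE (ED. 2: the record's `vol · (1 − q_v^{−(2s+1)})(1 − ε_v q_v^{−(2s+2)})∕(1 − q_v^{−2s}) · Σ_{k ≤ m_v}(ε_v q_v^{1−2s})^k`) and suppose the twisted D10 value at every
`v ∉ T₁`, `1 < re s`, is `Val v s (νN{u | ↑u ∈ K_{H,v}})` (`hGK`, from (K1a-2b)∕(2c) + the character reading + the good-place letters).  Then there is a finite `T₀ ⊇ T₁`
with, for every `v ∉ T₀`, every Haar `ν` on `unipDeltaLoc v` normalised by `ν(K_{H,v} ∩ N_Δ) = 1`, and every `1 < re s`: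
**`∫ y, conj ψ_S(ι_v y) · Λ_{s,v}((w_Δ)_v · y) dν(y) = Val v s 1`** (`T₀ = T₁ ∪ {v : χ ramified above v}`, ★ `isUnramifiedAt_cofinite_holds` under ★ `eventually_forall_placesOver`).
[cite: Tan1999, §3] [cite: KudlaRallis1994, §2] [cite: Shimura1997, §18.4] -/
theorem exists_finset_forall_integral_conjChar_lambdaLoc_weylDelta_eq (T₁ : Finset (HeightOneSpectrum (𝓞 (Fp L))))
    (Val : HeightOneSpectrum (𝓞 (Fp L)) → ℂ → ℝ → ℂ)
    (hGK : ∀ v ∉ T₁, ∀ s : ℂ, 1 < s.re → haveI : Algebra.IsQuadraticExtension (Fp L) L := IsCMField.isQuadraticExtension L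
      ∀ {_ : MeasurableSpace ↥(unipDeltaLocal (Fp L) L (IsCMField.complexConj L) v 2 (JD := hermD L e dV hdV dW hdW))} [BorelSpace ↥(unipDeltaLocal (Fp L) L (IsCMField.complexConj L) v 2 (JD := hermD L e dV hdV dW hdW))] (νN : Measure ↥(unipDeltaLocal (Fp L) L (IsCMField.complexConj L) v 2 (JD := hermD L e dV hdV dW hdW))) [νN.IsHaarMeasure] (f : UnitaryGroup.localPi L (IsCMField.complexConj L) (2 + 2) (hermD L e dV hdV dW hdW) v → ℂ),
        IsSphericalSection (Fp L) L (IsCMField.complexConj L) (complexConj_imagUnit L) (imagUnit_ne_zero L) (imagUnit_mul_self L) v 2 (gramR_isSymm L e dV hdV dW hdW) (hermD_eq_map_gramD L e dV hdV dW hdW) (fun w : UnitaryGroup.PlacesOver L v => χ.localComponent w.1) s f →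
          ∫ y, conj ((unipDeltaChar L e dV hdV dW hdW S (locToAdelic L e dV hdV dW hdW v (y : UnitaryGroup.localPi L (IsCMField.complexConj L) (2 + 2) (hermD L e dV hdV dW hdW) v)) : Circle) : ℂ) * f (weylDelta (Fp L) L (IsCMField.complexConj L) v 2 (hermD_eq_map_gramD L e dV hdV dW hdW) * (y : UnitaryGroup.localPi L (IsCMField.complexConj L) (2 + 2) (hermD L e dV hdV dW hdW) v)) ∂νN = Val v s (νN.real {u | (u : UnitaryGroup.localPi L (IsCMField.complexConj L) (2 + 2) (hermD L e dV hdV dW hdW) v) ∈ UnitaryGroup.localInt L (IsCMField.complexConj L) (2 + 2) (hermD L e dV hdV dW hdW) v})) :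
    ∃ T₀ : Finset (HeightOneSpectrum (𝓞 (Fp L))), ∀ v ∉ T₀,
      ∀ (ν : Measure ↥(unipDeltaLoc L e dV hdV dW hdW v)) [ν.IsHaarMeasure],
        ν (((inH (fun v => UnitaryGroup.localInt L (IsCMField.complexConj L) (2 + 2) (hermD L e dV hdV dW hdW) v) (fun v => unipDeltaLoc L e dV hdV dW hdW v) v) :
          Subgroup ↥(unipDeltaLoc L e dV hdV dW hdW v)) : Set ↥(unipDeltaLoc L e dV hdV dW hdW v)) = 1 →
        ∀ s : ℂ, 1 < s.re →
          ∫ y, conj ((unipDeltaChar L e dV hdV dW hdW S (locToAdelic L e dV hdV dW hdW v (y : UnitaryGroup.localPi L (IsCMField.complexConj L) (2 + 2) (hermD L e dV hdV dW hdW) v)) : Circle) : ℂ) * LambdaLoc L e dV hdV dW hdW v χ s (UnitaryGroup.evalPlace (Fp L) L (IsCMField.complexConj L) (2 + 2) (hermD L e dV hdV dW hdW) v (UnitaryGroup.finPart (Fp L) L (IsCMField.complexConj L) (2 + 2) (hermD L e dV hdV dW hdW) (SiegelDoubled.weylDelta L e dV hdV dW hdW)) * (y : UnitaryGroup.localPi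 L (IsCMField.complexConj L) (2 + 2) (hermD L e dV hdV dW hdW) v)) ∂ν = Val v s 1 := by
  classical
  obtain ⟨T₂, hT₂⟩ : ∃ T₂ : Finset (HeightOneSpectrum (𝓞 (Fp L))), ∀ v ∉ T₂, ∀ w : UnitaryGroup.PlacesOver L v, χ.IsUnramifiedAt w.1 :=
    ⟨(Filter.eventually_cofinite.1 (UnitaryGroup.eventually_forall_placesOver (F := Fp L) L (Q := fun w => χ.IsUnramifiedAt w)
        (HeckeCharacter.isUnramifiedAt_cofinite_holds χ))).toFinset, fun v hv => by
      by_contra h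
      exact hv ((Set.Finite.mem_toFinset _).2 h)⟩
  refine ⟨T₁ ∪ T₂, fun v hv ν _ hνK s hs => ?_⟩
  rw [Finset.mem_union, not_or] at hv
  exact integral_conjChar_lambdaLoc_weylDelta_eq_one_of_forall L e dV hdV dW hdW v ν S χ (hT₂ v hv.2) s (Val v s) hνK (hGK v hv.1 s hs)

end Cofinite


/-! ## §4 (ED. 2) The per-place discharge of the twisted D10 value at a good place -/

section Discharge

open Literature.NumberTheory.GaloisRepresentations.IsNonarchimedeanLocalField
open Summit.HodgeConjecture.HodgeConjecture.Cruxes.HLiu418.K2LiuQRationalDefs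
open Summit.HodgeConjecture.HodgeConjecture.Cruxes.HLiu418.K2LiuQRationalLFactor
open Summit.HodgeConjecture.HodgeConjecture.Cruxes.HLiu418.K2LiuLocalLFactorDefs
open Summit.HodgeConjecture.HodgeConjecture.Cruxes.HLiu418.K2LiuLocalSiegelIwasawaFrame
open Summit.HodgeConjecture.HodgeConjecture.Cruxes.HLiu418.K2LiuLocalSiegelIwasawa
open Summit.HodgeConjecture.HodgeConjecture.Cruxes.HLiu418.K2LiuDoubledUTwoTwoBorelFrame
open Summit.HodgeConjecture.HodgeConjecture.Cruxes.HLiu418.K2LiuDoubledUTwoTwoWeylCocycle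
open Summit.HodgeConjecture.HodgeConjecture.Cruxes.HLiu418.K2LiuDoubledUTwoTwoLevi
open Summit.HodgeConjecture.HodgeConjecture.Cruxes.HLiu418.K2LiuDoubledUTwoTwoFrameTransport
open Summit.HodgeConjecture.HodgeConjecture.Cruxes.HLiu418.K2LiuDoubledUTwoTwoUnipotentHaar
open Summit.HodgeConjecture.HodgeConjecture.Cruxes.HLiu418.K2LiuUnipDeltaRankOneCoordinates
open Summit.HodgeConjecture.HodgeConjecture.Cruxes.HLiu418.K2LiuSiegelCocycleLetters
open Summit.HodgeConjecture.HodgeConjecture.Cruxes.HLiu418.K2LiuA7NormalisedRegularitySetup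
open Summit.HodgeConjecture.HodgeConjecture.Cruxes.HLiu418.K2LiuRankOneSphericalStage
open Summit.HodgeConjecture.HodgeConjecture.Cruxes.HLiu418.K2LiuSiegelCocycleSphericalValueNormalised
open Summit.HodgeConjecture.HodgeConjecture.Cruxes.HLiu418.K2LiuSiegelCocycleLettersLocalInt
open Summit.HodgeConjecture.HodgeConjecture.Cruxes.HLiu418.K2LiuRankOneSingularLocalValue
open Summit.HodgeConjecture.HodgeConjecture.Cruxes.HLiu418.K2LiuRankOneSingularLocalValueSplit
open Summit.HodgeConjecture.HodgeConjecture.Cruxes.HLiu418.K2LiuRankOneWhittakerPolynomialSigned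
open Summit.HodgeConjecture.HodgeConjecture.Cruxes.HLiu418.K2LiuRankOneCornerCharacterReading
open Summit.HodgeConjecture.HodgeConjecture.Cruxes.HLiu418.K2LiuGKRankOneIdentityLFactor (isUnramifiedChar_chiF)

variable (L : Type) [Field L] [NumberField L] [IsCMField L] {N M₀ : ℕ} (e : Fin N × Fin M₀ ≃ Fin 2)
  (dV : Fin N → L) (hdV : ∀ i, IsCMField.complexConj L (dV i) = dV i)
  (dW : Fin M₀ → L) (hdW : ∀ i, IsCMField.complexConj L (dW i) = dW i)
  (v : HeightOneSpectrum (𝓞 (Fp L)))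
  (D Dinv : Matrix (Fin 2) (Fin 2) (Fp L)) (hDD : D * Dinv = 1) (hDD' : Dinv * D = 1) (Q : GL (Fin (2 + 2)) (Fp L))
  (hQm : (Q : Matrix (Fin (2 + 2)) (Fin (2 + 2)) (Fp L)) = Matrix.reindex (e₂ 2) (e₂ 2) (Matrix.fromBlocks 1 D 1 (-D)))
  (hQ : (Q : Matrix (Fin (2 + 2)) (Fin (2 + 2)) (Fp L))ᵀ * LocalSplitting.gramD (Fp L) 2 (gramR L e dV hdV dW hdW) * (Q : Matrix (Fin (2 + 2)) (Fin (2 + 2)) (Fp L)) =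
    (StdForm.antidiagonal (2 + 2)).over (Fp L))
  (hDinv : Dinv = (2 : Fp L) • ((1 : Matrix (Fin 2) (Fin 2) (Fp L)).submatrix Fin.rev id * gramR L e dV hdV dW hdW))
  (χ : HeckeCharacter L) (hχu : ∀ (w' : UnitaryGroup.PlacesOver L v) (x : (w'.1.adicCompletion L)ˣ), ‖((χ.localComponent w'.1 x : ℂˣ) : ℂ)‖ = 1)
  (hv : IsGoodPlace (Fp L) L (imagUnit L) v 2 (gramR L e dV hdV dW hdW) (fun w : UnitaryGroup.PlacesOver L v => χ.localComponent w.1))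
  (hDw : ∀ (w : UnitaryGroup.PlacesOver L v) (i j : Fin 2),
    ValuativeRel.valuation (w.1.adicCompletion L) (algebraMap L (w.1.adicCompletion L) (algebraMap (Fp L) L (D i j))) ≤ 1)
  (hDiw : ∀ (w : UnitaryGroup.PlacesOver L v) (i j : Fin 2),
    ValuativeRel.valuation (w.1.adicCompletion L) (algebraMap L (w.1.adicCompletion L) (algebraMap (Fp L) L (Dinv i j))) ≤ 1)
  (σ : L) {s : ℂ} (hs : 1 < s.re) {M : ℕ}
  (hM : (algebraMap (Fp L) (v.adicCompletion (Fp L)) (gramR L e dV hdV dW hdW 1 1 * Algebra.trace (Fp L) L (σ * imagUnit L))) ∈ primePowBall (v.adicCompletion (Fp L)) M) (hM' : (algebraMap (Fp L) (v.adicCompletion (Fp L)) (gramR L e dV hdV dW hdW 1 1 * Algebra.trace (Fp L) L (σ * imagUnit L))) ∉ primePowBall (v.adicCompletion (Fp L)) (M + 1))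

include hDD hQm hχu hv hDw hDiw hs hM hM' in
set_option maxHeartbeats 1600000 in -- MEASURED: 800 000 ✗ (`whnf`: the by-value cocycle relation spells eleven frame words on the K2Lit CM telescope) ∕ 1 600 000 ✓
/-- **THE TWISTED RANK-ONE STAGE IN THE CM FRAME, BY VALUE** (★ p862774 (LH7-p06) at `C₀ := C₃ = 1`, ★ FILE A §2; the `htw` letter of ★ (K1a-2b)): for every
right-`K_v`-invariant `Φ` on `U(J_Δ)(L⁺_v)` obeying the rank-one cocycle relation `Φ(φ(w₂)φ(u(x))g) = C₃·χ_F(x)⁻¹‖x‖^{−2s}·Φ(φ(w₂)φ(u⁻(x⁻¹))φ(w₂)g)` and `Φ(φ(w₂)) = Φ(1)`,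
`x ↦ ψ_v(xτ_v)Φ(φ(w₂)φ(u(x)))` is integrable and **`∫ ψ_v(xτ_v) Φ(φ(w₂)φ(u(x))) dμ(x) = μ(𝒪_v)·(L_F(2s,χ_F)⁻¹·Σ_{k≤M} (χ_F(ϖ)q^{1−2s})^k)·Φ(1)`**,
`τ_v = ι_v(t₁Tr(σδ)) ∈ 𝔭^M ∖ 𝔭^{M+1}` (`u(𝒪) ⊂ K_v` by ★ `frameConj_uLongTwo_coord_mem_localInt`, `C₃ = 1` by ★ `localSiegelCharacter_torusElt_negInvDelta_one_mul_prod_norm_eq_one`).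
[cite: Casselman1980, §3 Thm. 3.1] [cite: Tate1950, §2.5] [cite: KudlaRallis1994, §2] -/
theorem integrable_and_integral_addChar_mul_frameConj_eq [MeasurableSpace (v.adicCompletion (Fp L))] [BorelSpace (v.adicCompletion (Fp L))]
    (μF : Measure (v.adicCompletion (Fp L))) [μF.IsAddHaarMeasure] :
    haveI : Algebra.IsQuadraticExtension (Fp L) L := IsCMField.isQuadraticExtension L
    ∀ Φ : UnitaryGroup.localPi L (IsCMField.complexConj L) (2 + 2) (hermD L e dV hdV dW hdW) v → ℂ, (∀ g, ∀ k ∈ UnitaryGroup.localInt L (IsCMField.complexConj L) (2 + 2) (hermD L e dV hdV dW hdW) v, Φ (g * k) = Φ g) →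
      (∀ (x : (v.adicCompletion (Fp L))ˣ) (g : UnitaryGroup.localPi L (IsCMField.complexConj L) (2 + 2) (hermD L e dV hdV dW hdW) v),
        Φ (FrameTransport.frameConj (Fp L) L (IsCMField.complexConj L) v (2 + 2) (hermD_eq_map_gramD L e dV hdV dW hdW) (antidiagonal_over_eq_map (Fp L) L 2) Q hQ (toLocalFour (Fp L) L (IsCMField.complexConj L) v (weylTwo (UnitaryGroup.LocalRing L v) (UnitaryGroup.conjLocal L (IsCMField.complexConj L) v))) * FrameTransport.frameConj (Fp L) L (IsCMField.complexConj L) v (2 + 2) (hermD_eq_map_gramD L e dV hdV dW hdW) (antidiagonal_over_eq_map (Fp L) L 2) Q hQ (toLocalFour (Fp L) L (IsCMField.complexConj L) v (uLongTwo (UnitaryGroup.LocalRing L v) (UnitaryGroup.conjLocal L (IsCMField.complexConj L) v) (UnitaryGroup.toLocalRing L v (x : v.adicCompletion (Fp L)) * algebraMap L (UnitaryGroup.LocalRing L v) (imagUnit L)) (conjLocal_coord (Fp L) L (IsCMField.complexConj L) (complexConj_imagUnit L) v (x : v.adicCompletion (Fp L))))) * g) =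
          (localSiegelCharacter (Fp L) L (IsCMField.complexConj L) v 2 (fun w : UnitaryGroup.PlacesOver L v => χ.localComponent w.1) s (FrameTransport.frameConj (Fp L) L (IsCMField.complexConj L) v (2 + 2) (hermD_eq_map_gramD L e dV hdV dW hdW) (antidiagonal_over_eq_map (Fp L) L 2) Q hQ (toLocalFour (Fp L) L (IsCMField.complexConj L) v (torusElt (UnitaryGroup.LocalRing L v) (UnitaryGroup.conjLocal L (IsCMField.complexConj L) v) (UnitaryGroup.conjLocal_conjLocal (IsCMField.complexConj L) v (complexConj_imagUnit L) (imagUnit_ne_zero L)) (-((Units.mk0 (imagUnit L) (imagUnit_ne_zero L)).map (algebraMap L (UnitaryGroup.LocalRing L v) : L →* UnitaryGroup.LocalRing L v))⁻¹) (1)))) * ((∏ w' : UnitaryGroup.PlacesOver L v, ‖algebraMap L (UnitaryGroup.LocalRing L v) (imagUnit L) w'‖ : ℝ) : ℂ)) * (((((chiF (Fp L) L v (fun w : UnitaryGroup.PlacesOver L v => χ.localComponent w.1))) x)⁻¹ : ℂˣ) : ℂ) * ((normAbs (v.adicCompletion (Fp L)) (x : v.adicCompletion (Fp L)) : ℝ)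 : ℂ) ^ (-(2 * s)) *
            Φ (FrameTransport.frameConj (Fp L) L (IsCMField.complexConj L) v (2 + 2) (hermD_eq_map_gramD L e dV hdV dW hdW) (antidiagonal_over_eq_map (Fp L) L 2) Q hQ (toLocalFour (Fp L) L (IsCMField.complexConj L) v (weylTwo (UnitaryGroup.LocalRing L v) (UnitaryGroup.conjLocal L (IsCMField.complexConj L) v))) * FrameTransport.frameConj (Fp L) L (IsCMField.complexConj L) v (2 + 2) (hermD_eq_map_gramD L e dV hdV dW hdW) (antidiagonal_over_eq_map (Fp L) L 2) Q hQ (toLocalFour (Fp L) L (IsCMField.complexConj L) v (uLongTwo (UnitaryGroup.LocalRing L v) (UnitaryGroup.conjLocal L (IsCMField.complexConj L) v) (UnitaryGroup.toLocalRing L v ((x⁻¹ : (v.adicCompletion (Fp L))ˣ) : v.adicCompletion (Fp L)) * algebraMap L (UnitaryGroup.LocalRing L v) (imagUnit L)⁻¹) (conjLocal_coord_inv (Fp L) L (IsCMField.complexConj L) (complexConj_imagUnit L) v ((x⁻¹ : (v.adicCompletion (Fp L))ˣ) : v.adicCompletion (Fp L))))) * FrameTransport.frameConj (Fp L) L (IsCMField.complexConj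 L) v (2 + 2) (hermD_eq_map_gramD L e dV hdV dW hdW) (antidiagonal_over_eq_map (Fp L) L 2) Q hQ (toLocalFour (Fp L) L (IsCMField.complexConj L) v (weylTwo (UnitaryGroup.LocalRing L v) (UnitaryGroup.conjLocal L (IsCMField.complexConj L) v))) * g)) →
      Φ (FrameTransport.frameConj (Fp L) L (IsCMField.complexConj L) v (2 + 2) (hermD_eq_map_gramD L e dV hdV dW hdW) (antidiagonal_over_eq_map (Fp L) L 2) Q hQ (toLocalFour (Fp L) L (IsCMField.complexConj L) v (weylTwo (UnitaryGroup.LocalRing L v) (UnitaryGroup.conjLocal L (IsCMField.complexConj L) v))) * 1) = Φ 1 →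
      Integrable (fun x : v.adicCompletion (Fp L) => (((adeleAddCharAt (Fp L) v) (x * (algebraMap (Fp L) (v.adicCompletion (Fp L)) (gramR L e dV hdV dW hdW 1 1 * Algebra.trace (Fp L) L (σ * imagUnit L)))) : Circle) : ℂ) * Φ (FrameTransport.frameConj (Fp L) L (IsCMField.complexConj L) v (2 + 2) (hermD_eq_map_gramD L e dV hdV dW hdW) (antidiagonal_over_eq_map (Fp L) L 2) Q hQ (toLocalFour (Fp L) L (IsCMField.complexConj L) v (weylTwo (UnitaryGroup.LocalRing L v) (UnitaryGroup.conjLocal L (IsCMField.complexConj L) v))) * FrameTransport.frameConj (Fp L) L (IsCMField.complexConj L) v (2 + 2) (hermD_eq_map_gramD L e dV hdV dW hdW) (antidiagonal_over_eq_map (Fp L) L 2) Q hQ (toLocalFour (Fp L) L (IsCMField.complexConj L) v (uLongTwo (UnitaryGroup.LocalRing L v) (UnitaryGroup.conjLocal L (IsCMField.complexConj L) v) (UnitaryGroup.toLocalRing L v x * algebraMap L (UnitaryGroup.LocalRing L v) (imagUnit L)) (conjLocal_coord (Fp L) L (IsCMField.complexConj L) (complexConj_imagUnit L) v x))) * 1))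 μF ∧
        ∫ x, (((adeleAddCharAt (Fp L) v) (x * (algebraMap (Fp L) (v.adicCompletion (Fp L)) (gramR L e dV hdV dW hdW 1 1 * Algebra.trace (Fp L) L (σ * imagUnit L)))) : Circle) : ℂ) * Φ (FrameTransport.frameConj (Fp L) L (IsCMField.complexConj L) v (2 + 2) (hermD_eq_map_gramD L e dV hdV dW hdW) (antidiagonal_over_eq_map (Fp L) L 2) Q hQ (toLocalFour (Fp L) L (IsCMField.complexConj L) v (weylTwo (UnitaryGroup.LocalRing L v) (UnitaryGroup.conjLocal L (IsCMField.complexConj L) v))) * FrameTransport.frameConj (Fp L) L (IsCMField.complexConj L) v (2 + 2) (hermD_eq_map_gramD L e dV hdV dW hdW) (antidiagonal_over_eq_map (Fp L) L 2) Q hQ (toLocalFour (Fp L) L (IsCMField.complexConj L) v (uLongTwo (UnitaryGroup.LocalRing L v) (UnitaryGroup.conjLocal L (IsCMField.complexConj L) v) (UnitaryGroup.toLocalRing L v x * algebraMap L (UnitaryGroup.LocalRing L v) (imagUnit L)) (conjLocal_coord (Fp L) L (IsCMField.complexConj L) (complexConj_imagUnit L) v x))) * 1) ∂μF = (μF.real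 (primePowBall (v.adicCompletion (Fp L)) 0) : ℂ) * ((lFactor (Fp L) v (chiF (Fp L) L v (fun w : UnitaryGroup.PlacesOver L v => χ.localComponent w.1)) (2 * s))⁻¹ * ∑ k ∈ Finset.range (M + 1), (unramValue (Fp L) v (chiF (Fp L) L v (fun w : UnitaryGroup.PlacesOver L v => χ.localComponent w.1)) * (residueFieldCard (v.adicCompletion (Fp L)) : ℂ) ^ (1 - 2 * s)) ^ k) * Φ 1 := by
  intro Φ hΦK hrel hw₀
  haveI : Algebra.IsQuadraticExtension (Fp L) L := IsCMField.isQuadraticExtension L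
  have h2 := hv.two
  have hδv := hv.delta
  have hχ := hv.chi
  have hχ' : ∀ (w : UnitaryGroup.PlacesOver L v) (u : (w.1.adicCompletion L)ˣ), Valued.v (u : w.1.adicCompletion L) = 1 → χ.localComponent w.1 u = 1 :=
    fun w u hu => hχ w u ((valuation_eq_one_iff_valued L w.1 _).2 hu)
  have hνu : IsUnramifiedChar (chiF (Fp L) L v (fun w : UnitaryGroup.PlacesOver L v => χ.localComponent w.1)) := isUnramifiedChar_chiF (Fp L) L v (fun w : UnitaryGroup.PlacesOver L v => χ.localComponent w.1) hχ'
  have heC : 1 < (2 * s).re := by simp; linarith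
  have hC₃ : (localSiegelCharacter (Fp L) L (IsCMField.complexConj L) v 2 (fun w : UnitaryGroup.PlacesOver L v => χ.localComponent w.1) s (FrameTransport.frameConj (Fp L) L (IsCMField.complexConj L) v (2 + 2) (hermD_eq_map_gramD L e dV hdV dW hdW) (antidiagonal_over_eq_map (Fp L) L 2) Q hQ (toLocalFour (Fp L) L (IsCMField.complexConj L) v (torusElt (UnitaryGroup.LocalRing L v) (UnitaryGroup.conjLocal L (IsCMField.complexConj L) v) (UnitaryGroup.conjLocal_conjLocal (IsCMField.complexConj L) v (complexConj_imagUnit L) (imagUnit_ne_zero L)) (-((Units.mk0 (imagUnit L) (imagUnit_ne_zero L)).map (algebraMap L (UnitaryGroup.LocalRing L v) : L →* UnitaryGroup.LocalRing L v))⁻¹) (1)))) * ((∏ w' : UnitaryGroup.PlacesOver L v, ‖algebraMap L (UnitaryGroup.LocalRing L v) (imagUnit L) w'‖ : ℝ) : ℂ)) = 1 :=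
    localSiegelCharacter_torusElt_negInvDelta_one_mul_prod_norm_eq_one (Fp L) L (IsCMField.complexConj L) (complexConj_imagUnit L) (imagUnit_ne_zero L) v (hermD_eq_map_gramD L e dV hdV dW hdW) D Dinv hDD Q hQm hQ (fun w : UnitaryGroup.PlacesOver L v => χ.localComponent w.1) hχ hδv s
  have hmu1 : ∀ t ∈ primePowBall (v.adicCompletion (Fp L)) 0, (1 : UnitaryGroup.localPi L (IsCMField.complexConj L) (2 + 2) (hermD L e dV hdV dW hdW) v)⁻¹ * FrameTransport.frameConj (Fp L) L (IsCMField.complexConj L) v (2 + 2) (hermD_eq_map_gramD L e dV hdV dW hdW) (antidiagonal_over_eq_map (Fp L) L 2) Q hQ (toLocalFour (Fp L) L (IsCMField.complexConj L) v (uLongTwo (UnitaryGroup.LocalRing L v) (UnitaryGroup.conjLocal L (IsCMField.complexConj L) v) (UnitaryGroup.toLocalRing L v t * algebraMap L (UnitaryGroup.LocalRing L v) (imagUnit L)) (conjLocal_coord (Fp L) L (IsCMField.complexConj L) (complexConj_imagUnit L) v t))) * 1 ∈ UnitaryGroup.localInt L (IsCMField.complexConj L) (2 + 2) (hermD L e dV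 hdV dW hdW) v := fun t ht => by
    simpa only [inv_one, one_mul, mul_one] using frameConj_uLongTwo_coord_mem_localInt (Fp L) L (IsCMField.complexConj L) (complexConj_imagUnit L) v (hermD_eq_map_gramD L e dV hdV dW hdW) D Dinv hDD Q hQm hQ h2 hδv hDw hDiw t ht
  have hmū1 : ∀ t ∈ primePowBall (v.adicCompletion (Fp L)) 0, (1 : UnitaryGroup.localPi L (IsCMField.complexConj L) (2 + 2) (hermD L e dV hdV dW hdW) v)⁻¹ * (FrameTransport.frameConj (Fp L) L (IsCMField.complexConj L) v (2 + 2) (hermD_eq_map_gramD L e dV hdV dW hdW) (antidiagonal_over_eq_map (Fp L) L 2) Q hQ (toLocalFour (Fp L) L (IsCMField.complexConj L) v (weylTwo (UnitaryGroup.LocalRing L v) (UnitaryGroup.conjLocal L (IsCMField.complexConj L) v))) * FrameTransport.frameConj (Fp L) L (IsCMField.complexConj L) v (2 + 2) (hermD_eq_map_gramD L e dV hdV dW hdW) (antidiagonal_over_eq_map (Fp L) L 2) Q hQ (toLocalFour (Fp L) L (IsCMField.complexConj L) v (uLongTwo (UnitaryGroup.LocalRing L v) (UnitaryGroup.conjLocal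 L (IsCMField.complexConj L) v) (UnitaryGroup.toLocalRing L v t * algebraMap L (UnitaryGroup.LocalRing L v) (imagUnit L)⁻¹) (conjLocal_coord_inv (Fp L) L (IsCMField.complexConj L) (complexConj_imagUnit L) v t))) * FrameTransport.frameConj (Fp L) L (IsCMField.complexConj L) v (2 + 2) (hermD_eq_map_gramD L e dV hdV dW hdW) (antidiagonal_over_eq_map (Fp L) L 2) Q hQ (toLocalFour (Fp L) L (IsCMField.complexConj L) v (weylTwo (UnitaryGroup.LocalRing L v) (UnitaryGroup.conjLocal L (IsCMField.complexConj L) v)))) * 1 ∈ UnitaryGroup.localInt L (IsCMField.complexConj L) (2 + 2) (hermD L e dV hdV dW hdW) v := fun t ht => by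
    simpa only [inv_one, one_mul, mul_one] using Subgroup.mul_mem _ (Subgroup.mul_mem _
      (frameConj_weylTwo_mem_localInt (Fp L) L (IsCMField.complexConj L) v (hermD_eq_map_gramD L e dV hdV dW hdW) D Dinv hDD Q hQm hQ h2 hDw hDiw)
      (frameConj_uLongTwo_coord_inv_mem_localInt (Fp L) L (IsCMField.complexConj L) (complexConj_imagUnit L) v (hermD_eq_map_gramD L e dV hdV dW hdW) D Dinv hDD Q hQm hQ h2 hδv hDw hDiw t ht))
      (frameConj_weylTwo_mem_localInt (Fp L) L (IsCMField.complexConj L) v (hermD_eq_map_gramD L e dV hdV dW hdW) D Dinv hDD Q hQm hQ h2 hDw hDiw)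
  have hpair := integrable_and_integral_addChar_mul_apply_eq μF hΦK (u := fun y => FrameTransport.frameConj (Fp L) L (IsCMField.complexConj L) v (2 + 2) (hermD_eq_map_gramD L e dV hdV dW hdW) (antidiagonal_over_eq_map (Fp L) L 2) Q hQ (toLocalFour (Fp L) L (IsCMField.complexConj L) v (uLongTwo (UnitaryGroup.LocalRing L v) (UnitaryGroup.conjLocal L (IsCMField.complexConj L) v) (UnitaryGroup.toLocalRing L v y * algebraMap L (UnitaryGroup.LocalRing L v) (imagUnit L)) (conjLocal_coord (Fp L) L (IsCMField.complexConj L) (complexConj_imagUnit L) v y)))) (ū := fun t => FrameTransport.frameConj (Fp L) L (IsCMField.complexConj L) v (2 + 2) (hermD_eq_map_gramD L e dV hdV dW hdW) (antidiagonal_over_eq_map (Fp L) L 2) Q hQ (toLocalFour (Fp L) L (IsCMField.complexConj L) v (weylTwo (UnitaryGroup.LocalRing L v) (UnitaryGroup.conjLocal L (IsCMField.complexConj L) v))) * FrameTransport.frameConj (Fp L) L (IsCMField.complexConj L) v (2 + 2) (hermD_eq_map_gramD L e dV hdV dW hdW) (antidiagonal_over_eq_map (Fp L) L 2) Q hQ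 (toLocalFour (Fp L) L (IsCMField.complexConj L) v (uLongTwo (UnitaryGroup.LocalRing L v) (UnitaryGroup.conjLocal L (IsCMField.complexConj L) v) (UnitaryGroup.toLocalRing L v t * algebraMap L (UnitaryGroup.LocalRing L v) (imagUnit L)⁻¹) (conjLocal_coord_inv (Fp L) L (IsCMField.complexConj L) (complexConj_imagUnit L) v t))) * FrameTransport.frameConj (Fp L) L (IsCMField.complexConj L) v (2 + 2) (hermD_eq_map_gramD L e dV hdV dW hdW) (antidiagonal_over_eq_map (Fp L) L 2) Q hQ (toLocalFour (Fp L) L (IsCMField.complexConj L) v (weylTwo (UnitaryGroup.LocalRing L v) (UnitaryGroup.conjLocal L (IsCMField.complexConj L) v)))) (frameConj_uLongTwo_coord_add (Fp L) L (IsCMField.complexConj L) (complexConj_imagUnit L) v (hermD_eq_map_gramD L e dV hdV dW hdW) Q hQ) (FrameTransport.frameConj (Fp L) L (IsCMField.complexConj L) v (2 + 2) (hermD_eq_map_gramD L e dV hdV dW hdW) (antidiagonal_over_eq_map (Fp L) L 2) Q hQ (toLocalFour (Fp L) L (IsCMField.complexConj L) v (weylTwo (UnitaryGroup.LocalRing L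 v) (UnitaryGroup.conjLocal L (IsCMField.complexConj L) v)))) (chiF (Fp L) L v (fun w : UnitaryGroup.PlacesOver L v => χ.localComponent w.1))
        (norm_chiF_eq_one (F := Fp L) (E := L) hχu) hνu (2 * s) (localSiegelCharacter (Fp L) L (IsCMField.complexConj L) v 2 (fun w : UnitaryGroup.PlacesOver L v => χ.localComponent w.1) s (FrameTransport.frameConj (Fp L) L (IsCMField.complexConj L) v (2 + 2) (hermD_eq_map_gramD L e dV hdV dW hdW) (antidiagonal_over_eq_map (Fp L) L 2) Q hQ (toLocalFour (Fp L) L (IsCMField.complexConj L) v (torusElt (UnitaryGroup.LocalRing L v) (UnitaryGroup.conjLocal L (IsCMField.complexConj L) v) (UnitaryGroup.conjLocal_conjLocal (IsCMField.complexConj L) v (complexConj_imagUnit L) (imagUnit_ne_zero L)) (-((Units.mk0 (imagUnit L) (imagUnit_ne_zero L)).map (algebraMap L (UnitaryGroup.LocalRing L v) : L →* UnitaryGroup.LocalRing L v))⁻¹) (1)))) * ((∏ w' : UnitaryGroup.PlacesOver L v, ‖algebraMap L (UnitaryGroup.LocalRing L v) (imagUnit L) w'‖ : ℝ) : ℂ))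 heC hrel 1 hmu1 hmū1 hw₀ (continuous_adeleAddCharAt (Fp L) v) hv.psi hM hM'
  refine ⟨hpair.1, ?_⟩
  rw [hpair.2, hC₃, lFactor_def, inv_inv, (mul_cpow_neg_eq (F := v.adicCompletion (Fp L)) (unramValue (Fp L) v (chiF (Fp L) L v (fun w : UnitaryGroup.PlacesOver L v => χ.localComponent w.1))) (2 * s)).1,
    ← one_sub_mul_sum_sub_one_eq]
  ring

include hDD hDD' hQm hQ hDinv hχu hv hDw hDiw hs hM hM' in
set_option maxHeartbeats 1600000 in -- MEASURED: 800 000 ✗ (`whnf`: ★ (2b)'s binder list by value on the K2Lit CM telescope) ∕ 1 600 000 ✓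
/-- **THE TWISTED D10 VALUE AT A NON-SPLIT GOOD PLACE** (ED. 2; the discharge of §2's `hGK`): `w` the only place above `v`.  For every Haar `νN` on `N_Δ(L⁺_v)` and every
spherical section `f` of `I_v(s, (χ_w)_{w∣v})`, `1 < re s`:
`∫ conj ψ_{single 1 1 σ}(ι_v y) f(w_Δ y) dνN = νN{u | ↑u ∈ K_v} · L_F(2s+1,χ_F)∕L_F(2s+2,χ_F) · L_{E_w}(2s,χ∘N)∕L_{E_w}(2s+1,χ∘N) · (L_F(2s,χ_F)⁻¹ Σ_{k≤M} X^k)`,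
`X = χ_F(ϖ) q^{1−2s}`, `τ_v = ι_v(t₁·Tr(σδ)) ∈ 𝔭^M ∖ 𝔭^{M+1}`. [cite: Casselman1980, §3 Thm. 3.1] [cite: KudlaRallis1994, §2] [cite: Shimura1997, §18.4] [cite: Tate1950, §2.5] -/
theorem twistedValue_of_isSphericalSection_of_forall_eq (w : UnitaryGroup.PlacesOver L v) (hw : ∀ w' : UnitaryGroup.PlacesOver L v, w' = w) :
    haveI : Algebra.IsQuadraticExtension (Fp L) L := IsCMField.isQuadraticExtension L
    ∀ {_ : MeasurableSpace ↥(unipDeltaLocal (Fp L) L (IsCMField.complexConj L) v 2 (JD := hermD L e dV hdV dW hdW))} [BorelSpace ↥(unipDeltaLocal (Fp L) L (IsCMField.complexConj L) v 2 (JD := hermD L e dV hdV dW hdW))] (νN : Measure ↥(unipDeltaLocal (Fp L) L (IsCMField.complexConj L) v 2 (JD := hermD L e dV hdV dW hdW))) [νN.IsHaarMeasure] (f : UnitaryGroup.localPi L (IsCMField.complexConj L) (2 + 2) (hermD L e dV hdV dW hdW) v → ℂ),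
      IsSphericalSection (Fp L) L (IsCMField.complexConj L) (complexConj_imagUnit L) (imagUnit_ne_zero L) (imagUnit_mul_self L) v 2 (gramR_isSymm L e dV hdV dW hdW) (hermD_eq_map_gramD L e dV hdV dW hdW) (fun w : UnitaryGroup.PlacesOver L v => χ.localComponent w.1) s f →
        ∫ y, conj ((unipDeltaChar L e dV hdV dW hdW (Matrix.single 1 1 σ) (locToAdelic L e dV hdV dW hdW v (y : UnitaryGroup.localPi L (IsCMField.complexConj L) (2 + 2) (hermD L e dV hdV dW hdW) v)) : Circle) : ℂ) * f (weylDelta (Fp L) L (IsCMField.complexConj L) v 2 (hermD_eq_map_gramD L e dV hdV dW hdW) * (y : UnitaryGroup.localPi L (IsCMField.complexConj L) (2 + 2) (hermD L e dV hdV dW hdW) v)) ∂νN =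
          (νN.real {u | (u : UnitaryGroup.localPi L (IsCMField.complexConj L) (2 + 2) (hermD L e dV hdV dW hdW) v) ∈ UnitaryGroup.localInt L (IsCMField.complexConj L) (2 + 2) (hermD L e dV hdV dW hdW) v} : ℂ) * ((lFactor (Fp L) v (chiF (Fp L) L v (fun w : UnitaryGroup.PlacesOver L v => χ.localComponent w.1)) (2 * s + 2 - 1) / lFactor (Fp L) v (chiF (Fp L) L v (fun w : UnitaryGroup.PlacesOver L v => χ.localComponent w.1)) (2 * s + 2)) * (lFactor L w.1 (chiNorm (Fp L) L (IsCMField.complexConj L) v (fun w : UnitaryGroup.PlacesOver L v => χ.localComponent w.1) w) (2 * s + 1 - 1) / lFactor L w.1 (chiNorm (Fp L) L (IsCMField.complexConj L) v (fun w : UnitaryGroup.PlacesOver L v => χ.localComponent w.1) w) (2 * s + 1)) * ((lFactor (Fp L) v (chiF (Fp L) L v (fun w : UnitaryGroup.PlacesOver L v => χ.localComponent w.1)) (2 * s))⁻¹ * ∑ k ∈ Finset.range (M + 1), (unramValue (Fp L) v (chiF (Fp L) L v (fun w : UnitaryGroup.PlacesOver L v => χ.localComponent w.1)) * (residueFieldCard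 (v.adicCompletion (Fp L)) : ℂ) ^ (1 - 2 * s)) ^ k)) := by
  intro _ _ νN _ f hf
  haveI : Algebra.IsQuadraticExtension (Fp L) L := IsCMField.isQuadraticExtension L
  -- the place letters
  have h2 := hv.two
  have hδv := hv.delta
  have hχ := hv.chi
  -- Borel structure and Haar measure on `L⁺_v`, the cocycle coordinates, the partial Weyl letter
  borelize (v.adicCompletion (Fp L))
  haveI := secondCountableTopology_adicCompletion (Fp L) v
  obtain ⟨μF, hμF⟩ : ∃ μ : Measure (v.adicCompletion (Fp L)), μ.IsAddHaarMeasure := ⟨Measure.addHaar, inferInstance⟩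
  obtain ⟨ec, hec, hecadd⟩ := exists_homeomorph_coordTwo (Fp L) L (IsCMField.complexConj L) (complexConj_imagUnit L) (imagUnit_ne_zero L) v (hermD_eq_map_gramD L e dV hdV dW hdW) D Dinv hDD hDD' Q hQm hQ
  obtain ⟨A, hA⟩ := exists_partialWeylGL (Fp L) L v w
  have hfK : ∀ g, ∀ k ∈ UnitaryGroup.localInt L (IsCMField.complexConj L) (2 + 2) (hermD L e dV hdV dW hdW) v, f (g * k) = f g := fun g k hk => hf.apply_mul_of_mem_localInt hk g
  -- the character in the frame (📤 p862906 §3): it depends on the first coordinate only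
  have hchar : ∀ u : ↥(unipDeltaLocal (Fp L) L (IsCMField.complexConj L) v 2 (JD := hermD L e dV hdV dW hdW)),
      conj ((unipDeltaChar L e dV hdV dW hdW (Matrix.single 1 1 σ) (locToAdelic L e dV hdV dW hdW v (u : UnitaryGroup.localPi L (IsCMField.complexConj L) (2 + 2) (hermD L e dV hdV dW hdW) v)) : Circle) : ℂ) =
        (((adeleAddCharAt (Fp L) v) ((ec.symm u).1 * (algebraMap (Fp L) (v.adicCompletion (Fp L)) (gramR L e dV hdV dW hdW 1 1 * Algebra.trace (Fp L) L (σ * imagUnit L)))) : Circle) : ℂ) := fun u => by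
    obtain ⟨⟨b₁, z, b₂⟩, rfl⟩ := ec.surjective u
    rw [Homeomorph.symm_apply_apply, hec]
    exact conj_unipDeltaChar_single_locToAdelic_frameConj_nSiegel L e dV hdV dW hdW v D Dinv hDD Q hQm hQ hDinv σ b₁ z b₂
  simp_rw [hchar]
  -- the twisted stage BY VALUE (★ p862774, LH7-p06) at `C₀ := C₃ = 1` (★ FILE A §2)
  -- ★ (K1a-2b) at `K₀ := K_v`, `h := 1`
  have h2b := integral_addChar_mul_eq_of_spherical_of_forall_eq (Fp L) L (IsCMField.complexConj L) (complexConj_imagUnit L) (imagUnit_ne_zero L) (imagUnit_mul_self L) v (gramR_isSymm L e dV hdV dW hdW) (hermD_eq_map_gramD L e dV hdV dW hdW) D Dinv hDD Q hQm hQ μF ec hec hecadd νN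
    (fun w : UnitaryGroup.PlacesOver L v => χ.localComponent w.1) hχu (UnitaryGroup.localInt L (IsCMField.complexConj L) (2 + 2) (hermD L e dV hdV dW hdW) v) (UnitaryGroup.isOpen_localInt L (IsCMField.complexConj L) (2 + 2) (hermD L e dV hdV dW hdW) v) hs hf.isLocalSiegelSection hf.isSmooth hfK w hw A hA
    (frameConj_weylTwo_mem_localInt (Fp L) L (IsCMField.complexConj L) v (hermD_eq_map_gramD L e dV hdV dW hdW) D Dinv hDD Q hQm hQ h2 hDw hDiw)
    (frameConj_leviElt_partialWeyl_mem_localInt (Fp L) L (IsCMField.complexConj L) (complexConj_imagUnit L) (imagUnit_ne_zero L) v (hermD_eq_map_gramD L e dV hdV dW hdW) D Dinv hDD Q hQm hQ h2 hDw hDiw w A hA)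
    (fun t ht => frameConj_uLongTwo_coord_mem_localInt (Fp L) L (IsCMField.complexConj L) (complexConj_imagUnit L) v (hermD_eq_map_gramD L e dV hdV dW hdW) D Dinv hDD Q hQm hQ h2 hδv hDw hDiw t ht)
    (fun t ht => frameConj_uLongTwo_coord_inv_mem_localInt (Fp L) L (IsCMField.complexConj L) (complexConj_imagUnit L) v (hermD_eq_map_gramD L e dV hdV dW hdW) D Dinv hDD Q hQm hQ h2 hδv hDw hDiw t ht)
    (fun ζ hζ => frameConj_uMinus_single_mem_localInt (Fp L) L (IsCMField.complexConj L) (complexConj_imagUnit L) (imagUnit_ne_zero L) v (hermD_eq_map_gramD L e dV hdV dW hdW) D Dinv hDD Q hQm hQ h2 hDw hDiw w ζ hζ) 1 (one_mem _)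
    (adeleAddCharAt (Fp L) v) (continuous_adeleAddCharAt (Fp L) v) (algebraMap (Fp L) (v.adicCompletion (Fp L)) (gramR L e dV hdV dW hdW 1 1 * Algebra.trace (Fp L) L (σ * imagUnit L))) ((lFactor (Fp L) v (chiF (Fp L) L v (fun w : UnitaryGroup.PlacesOver L v => χ.localComponent w.1)) (2 * s))⁻¹ * ∑ k ∈ Finset.range (M + 1), (unramValue (Fp L) v (chiF (Fp L) L v (fun w : UnitaryGroup.PlacesOver L v => χ.localComponent w.1)) * (residueFieldCard (v.adicCompletion (Fp L)) : ℂ) ^ (1 - 2 * s)) ^ k)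
    (integrable_and_integral_addChar_mul_frameConj_eq L e dV hdV dW hdW v D Dinv hDD Q hQm hQ χ hχu hv hDw hDiw σ hs hM hM' μF)
  rw [show (∫ y, ((adeleAddCharAt (Fp L) v ((ec.symm y).1 * (algebraMap (Fp L) (v.adicCompletion (Fp L)) (gramR L e dV hdV dW hdW 1 1 * Algebra.trace (Fp L) L (σ * imagUnit L)))) : Circle) : ℂ) * f (weylDelta (Fp L) L (IsCMField.complexConj L) v 2 (hermD_eq_map_gramD L e dV hdV dW hdW) * (y : UnitaryGroup.localPi L (IsCMField.complexConj L) (2 + 2) (hermD L e dV hdV dW hdW) v)) ∂νN) =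
      ∫ y, ((adeleAddCharAt (Fp L) v ((ec.symm y).1 * (algebraMap (Fp L) (v.adicCompletion (Fp L)) (gramR L e dV hdV dW hdW 1 1 * Algebra.trace (Fp L) L (σ * imagUnit L)))) : Circle) : ℂ) * f (weylDelta (Fp L) L (IsCMField.complexConj L) v 2 (hermD_eq_map_gramD L e dV hdV dW hdW) * (y : UnitaryGroup.localPi L (IsCMField.complexConj L) (2 + 2) (hermD L e dV hdV dW hdW) v) * 1) ∂νN by
    simp only [mul_one]]
  rw [h2b, hf.apply_one, mul_one,
    localSiegelCharacter_weylDelta_mul_frameConj_weylSiegel_eq_one (Fp L) L (IsCMField.complexConj L) v (hermD_eq_map_gramD L e dV hdV dW hdW) D Dinv hDD Q hQm hQ (fun w : UnitaryGroup.PlacesOver L v => χ.localComponent w.1) hχ (valuation_det_eq_one_of_integral (Fp L) L v hDD hDw hDiw) s,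
    localSiegelCharacter_torusElt_one_negInvDelta_eq_one (Fp L) L (IsCMField.complexConj L) (complexConj_imagUnit L) (imagUnit_ne_zero L) v (hermD_eq_map_gramD L e dV hdV dW hdW) D Dinv hDD Q hQm hQ (fun w : UnitaryGroup.PlacesOver L v => χ.localComponent w.1) hχ hδv s,
    chi_neg_one_eq_one (Fp L) L v (fun w : UnitaryGroup.PlacesOver L v => χ.localComponent w.1) hχ w, one_mul, one_mul, one_mul,
    one_add_eq_lFactor_div_lFactor (chiF (Fp L) L v (fun w : UnitaryGroup.PlacesOver L v => χ.localComponent w.1)) (norm_chiF_eq_one (F := Fp L) (E := L) hχu) (by simp; linarith : 1 < (2 * s + 2).re),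
    one_add_eq_lFactor_div_lFactor (chiNorm (Fp L) L (IsCMField.complexConj L) v (fun w : UnitaryGroup.PlacesOver L v => χ.localComponent w.1) w) (norm_chiNorm_eq_one (F := Fp L) (E := L) (c := (IsCMField.complexConj L)) hχu w) (by simp; linarith : 1 < (2 * s + 1).re),
    box_eq_setOf_mem_localInt_of_forall_eq (Fp L) L (IsCMField.complexConj L) (complexConj_imagUnit L) (imagUnit_ne_zero L) v (hermD_eq_map_gramD L e dV hdV dW hdW) D Dinv hDD hDD' Q hQm hQ h2 hδv hDw hDiw w hw]

end Discharge

end Summit.HodgeConjecture.HodgeConjecture.Cruxes.HLiu418.K2LiuRankOneSingularLocalValueCM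

end
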